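import Literature.NumberTheory.LFunctions.EnergyThirdMoment
import Literature.NumberTheory.LFunctions.LargeValuesTraceExpansion
import Literature.Analysis.Fourier.VanDerCorput
import HarnessLib

/-!
# The approximate functional equation for `B_N(τ) = ∑_{m≠0} ĥ_τ(mN)` (Guth–Maynard Lemma 6.2) and the mean square of `B_N` over dyadic classes

Topic `NumberTheory/LFunctions`, family RH. `LargeValuesAssembly.lean` reduces the tree's named fact
`Literature.NumberTheory.LFunctions.zeroDensity_guth_maynard` (L. Guth, J. Maynard, *New large value
estimates for Dirichlet polynomials*, Ann. of Math. 203 (2026), Theorem 1.2) to Propositions 6.1, 10.1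
and 11.1 of the paper (`GuthMaynardAssembly.zeroDensity_guth_maynard_of_bounds`, hypotheses `hS2`,
`hS3`, `hE`). This file is the first half of **§6 (Proposition 6.1, the `S₂` bound)**: it PROVES
Lemma 6.2 of the paper ("Approximate functional equation") for the Poisson coefficients
`B_N(τ) = ∑_{m ≠ 0} ĥ_τ(mN)` (`GuthMaynardFourier.coefB`) of `LargeValuesTraceExpansion.lean`, in an
exact form, and the resulting mean-square bound for `B_N` over a dyadic class of differences
`T₀ ≤ |t − t'| ≤ 2T₀` in terms of double zeta sums of Dirichlet polynomials of length `M ≍ T₀/N`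
(the display (6.2) of the paper). The second half of §6 (Hölder, the divisor bound and Heath-Brown's
theorem, giving `hS2`) is the subject of a sequel file.

* §1 `oscInt`, `norm_integral_oscInt_le_block`, `norm_integral_oscInt_le_dyadic` — the oscillatory
  integral `∫ v^{-1+iθ} e^{isv} dv`: `≤ 24|θ|^{-1/2}` over `[a, 2a]` (van der Corput's second-derivative
  test, tree `Literature.Analysis.Fourier.norm_integral_exp_I_mul_le_of_abs_second_deriv_ge`, and a
  partial integration of the amplitude `1/v`), hence `≤ 24K|θ|^{-1/2}` over `[a, 2^K a]`.
* §2 `mel`, `weight_sq_eq_integral` — the Mellin transform `H(s) = ∫ w(u)² u^{s−1} du` on `re s = 1`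
  as the Fourier transform `H_w = 𝓕ψ_w` of `ψ_w(v) = e^v w(e^v)²` (`GuthMaynardFourier.expWeight`), its
  decay, and Mellin inversion `w(u)² = u^{-1}∫ H_w(ξ) u^{2πiξ} dξ` (Fourier inversion, Mathlib).
* §3 **Lemma 6.2, exact form** `sum_fourier_hFun_eq`: for `N > 0`, `M ≥ 1`, real `t, ε`,
  `∑_{m=1}^{M} ĥ_t(εNm) = ∫ H_w(ξ) N^{-iθ} D_M(θ) J_{N,M}(θ) dξ`, `θ = t + 2πξ`, with
  `D_M(θ) = ∑_{m ≤ M} m^{-iθ}` (`dirD`) and `J_{N,M}(θ) = ∫_N^{2MN} v^{-1+iθ} e(−εv) dv` (`Jint`)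
  (Mellin inversion inside `ĥ_t(εNm) = ∫_{1/m}^{2M/m} w(u)²u^{it}e(−εNmu) du`, Fubini, `v = Nmu`).
* §4 `norm_coefB_sub_sum_le` (truncation `|m| > M`, from Lemma 4.3), `integral_indicator_norm_mel_le`
  (tail of `H_w`), `norm_sum_fourier_hFun_le` — **Lemma 6.2 as printed**:
  `|∑_{m≤M} ĥ_τ(εNm)| ≤ 24√2 K|τ|^{-1/2}∫|H_w(ξ)||D_M(τ+2πξ)|dξ + M log(2M)∫_{|ξ|≥|τ|/4π}|H_w|`.
* §5 `norm_coefB_le_main_add`, `norm_coefB_sq_le` (Cauchy–Schwarz in `ξ`), `dirD_sub_add`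
  (`D_M(t−t'+2πξ) = ∑_m m^{-2πiξ} m^{i(t'−t)}`, unimodular coefficients) and the export
  **`sum_sq_norm_coefB_le`**: for `j ≥ 2` there is `C = C(w,j)` with
  `∑_{t,t'∈W, T₀≤|t−t'|≤2T₀} |B_N(t−t')|² ≤ C K² Φ/T₀ + C|W|²((M log 2M)²T₀^{-2j} + (1+2T₀)^{2j}N^{-2j}M^{4−2j})`
  whenever `∑_{t,t'∈W} |D_M(t−t'+2πξ)|² ≤ Φ` for all `ξ` (`N ≥ 1`, `1 ≤ M`, `2M ≤ 2^K`, `T₀ ≥ 1`).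

Deviations from the letter of the paper (constants only): the `r`-integral is not truncated to
`|r| ⪅ 1` — the rapidly decaying weight `|H(1+ir)|` is kept inside (as in the tree's treatment of
Lemma 11.3), the part `|r| > |τ|/2` being bounded trivially; the paper's `r` is `−2πξ` here; both signs
of `m` are treated by the same identity (parameter `ε = ±1`). No named fact is introduced; everything
in this file is proved. Definitions (with bodies): `oscPhase`, `oscInt`, `expWeightR`, `mel`,
`invKernel`, `Jint`, `dirD`.

## References

* L. Guth, J. Maynard, *New large value estimates for Dirichlet polynomials*, Ann. of Math. (2)
  203 (2026), no. 2; arXiv:2405.20552 (2024): §6, Lemma 6.2 and its proof, proof of Proposition 6.1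
  up to (6.2). [key `GuthMaynard2026`]
* H. L. Montgomery, *Ten lectures on the interface between analytic number theory and harmonic
  analysis* (1994), ch. 3 (the cite `[M2]` of the paper for the van der Corput bounds).
-/

noncomputable section

open Real Set Filter Topology Complex MeasureTheory Finset
open scoped FourierTransform ContDiff

namespace Literature.NumberTheory.LFunctions

namespace GuthMaynardS2

open GuthMaynardFourier GuthMaynardEnergy GuthMaynardRFunction Literature.Analysis.Fourier

/-! ## §1. The oscillatory integral `∫ v^{-1+iθ} e^{isv} dv` over dyadic ranges -/

/-- The phase `φ_{θ,s}(v) = θ log v + s v`. [folklore] -/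
def oscPhase (θ s v : ℝ) : ℝ := θ * Real.log v + s * v

/-- The integrand `v^{-1} e^{iφ_{θ,s}(v)} = v^{-1+iθ} e^{isv}`. [folklore] -/
def oscInt (θ s v : ℝ) : ℂ := ((v : ℝ) : ℂ)⁻¹ * Complex.exp (I * (oscPhase θ s v : ℝ))

/-- `φ_{θ,s}'(v) = θ/v + s` for `v > 0`. [folklore] -/
theorem hasDerivAt_oscPhase (θ s : ℝ) {v : ℝ} (hv : 0 < v) :
    HasDerivAt (oscPhase θ s) (θ / v + s) v := by
  have h1 : HasDerivAt (fun v ↦ θ * Real.log v) (θ * v⁻¹) v :=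
    (Real.hasDerivAt_log hv.ne').const_mul θ
  have h2 : HasDerivAt (fun v ↦ s * v) (s * 1) v := (hasDerivAt_id v).const_mul s
  have h := h1.add h2
  refine h.congr_deriv ?_
  rw [div_eq_mul_inv, mul_one]

/-- `(θ/v + s)' = −θ/v²` for `v > 0`. [folklore] -/
theorem hasDerivAt_oscPhase' (θ s : ℝ) {v : ℝ} (hv : 0 < v) :
    HasDerivAt (fun v ↦ θ / v + s) (-θ / v ^ 2) v := by
  have h1 : HasDerivAt (fun v ↦ θ * v⁻¹) (θ * (-(v ^ 2)⁻¹)) v :=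
    (hasDerivAt_inv hv.ne').const_mul θ
  have h := h1.add_const s
  have e : (fun v ↦ θ * v⁻¹ + s) = fun v ↦ θ / v + s := by ext; rw [div_eq_mul_inv]
  rw [e] at h
  refine h.congr_deriv ?_
  rw [neg_div, div_eq_mul_inv, mul_neg]

/-- `|v^{-1+iθ} e^{isv}| = 1/v` for `v > 0`. [folklore] -/
theorem norm_oscInt {θ s v : ℝ} (hv : 0 < v) : ‖oscInt θ s v‖ = v⁻¹ := by
  rw [oscInt, norm_mul, norm_inv, Complex.norm_real, Real.norm_of_nonneg hv.le,
    Complex.norm_exp_I_mul_ofReal, mul_one]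

/-- The integrand is continuous away from `0`. [folklore] -/
theorem continuousAt_oscInt (θ s : ℝ) {v : ℝ} (hv : v ≠ 0) : ContinuousAt (oscInt θ s) v := by
  unfold oscInt oscPhase
  have h1 : ContinuousAt (fun v : ℝ ↦ ((v : ℝ) : ℂ)⁻¹) v :=
    (Complex.continuous_ofReal.continuousAt).inv₀ (by exact_mod_cast hv)
  have h2 : ContinuousAt (fun v : ℝ ↦ θ * Real.log v + s * v) v :=
    ((Real.continuousAt_log hv).const_mul θ).add (continuousAt_id.const_mul s)
  have h3 : ContinuousAt (fun v : ℝ ↦ Complex.exp (I * ((θ * Real.log v + s * v : ℝ) : ℂ))) v :=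
    (continuousAt_const.mul (Complex.continuous_ofReal.continuousAt.comp h2)).cexp
  exact h1.mul h3

/-- The integrand is continuous on `[a, b]` for `a > 0`. [folklore] -/
theorem continuousOn_oscInt (θ s : ℝ) {a b : ℝ} (ha : 0 < a) :
    ContinuousOn (oscInt θ s) (Icc a b) := fun v hv ↦
  (continuousAt_oscInt θ s (by linarith [hv.1] : 0 < v).ne').continuousWithinAt

/-- The integrand is interval integrable on `[a, b]` for `0 < a ≤ b`. [folklore] -/
theorem intervalIntegrable_oscInt (θ s : ℝ) {a b : ℝ} (ha : 0 < a) (hab : a ≤ b) :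
    IntervalIntegrable (oscInt θ s) volume a b :=
  (continuousOn_oscInt θ s ha).intervalIntegrable_of_Icc hab

/-- The trivial bound `|∫_a^b v^{-1+iθ}e^{isv} dv| ≤ log(b/a)`. [folklore] -/
theorem norm_integral_oscInt_le_log (θ s : ℝ) {a b : ℝ} (ha : 0 < a) (hab : a ≤ b) :
    ‖∫ v in a..b, oscInt θ s v‖ ≤ Real.log (b / a) := by
  have hb : 0 < b := by linarith
  calc ‖∫ v in a..b, oscInt θ s v‖ ≤ ∫ v in a..b, ‖oscInt θ s v‖ :=
        intervalIntegral.norm_integral_le_integral_norm hab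
    _ = ∫ v in a..b, v⁻¹ := by
        refine intervalIntegral.integral_congr fun v hv ↦ ?_
        rw [uIcc_of_le hab] at hv
        exact norm_oscInt (by linarith [hv.1])
    _ = Real.log (b / a) := integral_inv_of_pos ha hb

/-- Second-derivative test for the phase `θ log v + sv` (`|φ''| = |θ|/v² ≥ |θ|/b²` on `[a, x]`,
`x ≤ b`): `|∫_a^x e^{iφ}| ≤ 8b|θ|^{-1/2}`. [folklore] -/
theorem norm_integral_exp_oscPhase_le {θ s a x b : ℝ} (ha : 0 < a) (hax : a ≤ x) (hxb : x ≤ b)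
    (hθ : θ ≠ 0) :
    ‖∫ v in a..x, Complex.exp (I * (oscPhase θ s v : ℝ))‖ ≤ 8 * b / Real.sqrt |θ| := by
  have hb : 0 < b := by linarith
  have hθ0 : 0 < |θ| := abs_pos.mpr hθ
  have hδ : 0 < |θ| / b ^ 2 := by positivity
  have key := norm_integral_exp_I_mul_le_of_abs_second_deriv_ge (φ := oscPhase θ s)
    (φ' := fun v ↦ θ / v + s) (φ'' := fun v ↦ -θ / v ^ 2) hax hδ
    (fun v hv ↦ hasDerivAt_oscPhase θ s (by linarith [hv.1]))
    (fun v hv ↦ hasDerivAt_oscPhase' θ s (by linarith [hv.1]))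
    (by
      refine continuousOn_of_forall_continuousAt fun v hv ↦ ?_
      have hv0 : v ≠ 0 := by linarith [hv.1]
      exact (continuousAt_const.div (continuousAt_id.pow 2) (pow_ne_zero 2 hv0)))
    (by
      intro v hv
      have hv0 : 0 < v := by linarith [hv.1]
      rw [neg_div, abs_neg, abs_div, abs_of_pos (pow_pos hv0 2)]
      exact div_le_div_of_nonneg_left hθ0.le (pow_pos hv0 2)
        (pow_le_pow_left₀ hv0.le (by linarith [hv.2]) 2))
  refine key.trans (le_of_eq ?_)
  rw [Real.sqrt_div hθ0.le, Real.sqrt_sq hb.le]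
  field_simp

/-- **One dyadic block**: for `0 < a ≤ b ≤ 2a` and `θ ≠ 0`,
`|∫_a^b v^{-1+iθ} e^{isv} dv| ≤ 24|θ|^{-1/2}` (second-derivative test and partial integration of
the amplitude `1/v`; the "Van-der-Corput … second derivative bound" of the paper).
[cite: GuthMaynard2026, proof of Lemma 6.2] -/
theorem norm_integral_oscInt_le_block {θ s a b : ℝ} (ha : 0 < a) (hab : a ≤ b) (hb2 : b ≤ 2 * a)
    (hθ : θ ≠ 0) : ‖∫ v in a..b, oscInt θ s v‖ ≤ 24 / Real.sqrt |θ| := by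
  have hb : 0 < b := by linarith
  have hθ0 : 0 < Real.sqrt |θ| := Real.sqrt_pos.mpr (abs_pos.mpr hθ)
  set f : ℝ → ℂ := fun v ↦ Complex.exp (I * (oscPhase θ s v : ℝ)) with hf
  set E : ℝ → ℂ := fun x ↦ ∫ v in a..x, f v with hE
  have huIcc : uIcc a b = Icc a b := uIcc_of_le hab
  -- continuity of `f` away from `0`
  have hfc : ∀ v : ℝ, v ≠ 0 → ContinuousAt f v := by
    intro v hv
    have h2 : ContinuousAt (fun v : ℝ ↦ θ * Real.log v + s * v) v :=
      ((Real.continuousAt_log hv).const_mul θ).add (continuousAt_id.const_mul s)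
    exact (continuousAt_const.mul (Complex.continuous_ofReal.continuousAt.comp h2)).cexp
  have hfco : ContinuousOn f (Ioi 0) := fun v hv ↦ (hfc v (ne_of_gt hv)).continuousWithinAt
  have hfi : ∀ x y : ℝ, 0 < x → 0 < y → IntervalIntegrable f volume x y := by
    intro x y hx hy
    refine (hfco.mono fun v hv ↦ ?_).intervalIntegrable
    exact lt_of_lt_of_le (lt_min hx hy) hv.1
  -- `E' = f` on `[a, b]`
  have hEd : ∀ x ∈ uIcc a b, HasDerivAt E (f x) x := by
    intro x hx
    rw [huIcc] at hx
    have hx0 : 0 < x := by linarith [hx.1]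
    exact intervalIntegral.integral_hasDerivAt_right (hfi a x ha hx0)
      (hfco.stronglyMeasurableAtFilter isOpen_Ioi x hx0) (hfc x hx0.ne')
  -- `|E(x)| ≤ 8b/√|θ|` on `[a, b]`
  have hEb : ∀ x, a ≤ x → x ≤ b → ‖E x‖ ≤ 8 * b / Real.sqrt |θ| := fun x hax hxb ↦
    norm_integral_exp_oscPhase_le ha hax hxb hθ
  -- the amplitude `u = 1/v`
  set u : ℝ → ℂ := fun v ↦ ((v : ℝ) : ℂ)⁻¹ with hu
  set u' : ℝ → ℂ := fun v ↦ ((-(v ^ 2)⁻¹ : ℝ) : ℂ) with hu'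
  have hud : ∀ x ∈ uIcc a b, HasDerivAt u (u' x) x := by
    intro x hx
    rw [huIcc] at hx
    have hx0 : x ≠ 0 := by linarith [hx.1]
    have h1 := (hasDerivAt_inv hx0).ofReal_comp
    have e : (fun y : ℝ ↦ (((y⁻¹ : ℝ)) : ℂ)) = u := by ext y; simp [hu]
    rw [e] at h1
    exact h1
  have hu'c : ContinuousOn u' (uIcc a b) := by
    rw [huIcc]
    refine continuousOn_of_forall_continuousAt fun x hx ↦ ?_
    have hx0 : x ≠ 0 := by linarith [hx.1]
    exact Complex.continuous_ofReal.continuousAt.comp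
      ((continuousAt_id.pow 2).inv₀ (pow_ne_zero 2 hx0)).neg
  have hibp := intervalIntegral.integral_mul_deriv_eq_deriv_mul hud hEd
    hu'c.intervalIntegrable (hfi a b ha hb)
  have hEa : E a = 0 := by simp [hE]
  have hlhs : ∫ v in a..b, oscInt θ s v = ∫ v in a..b, u v * f v := rfl
  rw [hlhs, hibp, hEa, mul_zero, sub_zero]
  -- bound the two pieces
  have h1 : ‖u b * E b‖ ≤ 8 / Real.sqrt |θ| := by
    rw [norm_mul, hu]
    simp only [norm_inv, Complex.norm_real, Real.norm_of_nonneg hb.le]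
    calc b⁻¹ * ‖E b‖ ≤ b⁻¹ * (8 * b / Real.sqrt |θ|) :=
          mul_le_mul_of_nonneg_left (hEb b hab le_rfl) (by positivity)
      _ = 8 / Real.sqrt |θ| := by field_simp
  have h2 : ‖∫ x in a..b, u' x * E x‖ ≤ (a ^ 2)⁻¹ * (8 * b / Real.sqrt |θ|) * |b - a| := by
    refine intervalIntegral.norm_integral_le_of_norm_le_const fun x hx ↦ ?_
    rw [uIoc_of_le hab] at hx
    have hx0 : 0 < x := by linarith [hx.1]
    rw [norm_mul]
    refine mul_le_mul ?_ (hEb x hx.1.le hx.2) (norm_nonneg _) (by positivity)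
    rw [hu']
    simp only [Complex.norm_real, norm_neg, norm_inv, norm_pow, Real.norm_of_nonneg hx0.le]
    exact inv_anti₀ (by positivity) (pow_le_pow_left₀ ha.le hx.1.le 2)
  have h3 : (a ^ 2)⁻¹ * (8 * b / Real.sqrt |θ|) * |b - a| ≤ 16 / Real.sqrt |θ| := by
    rw [abs_of_nonneg (sub_nonneg.mpr hab)]
    rw [show (a ^ 2)⁻¹ * (8 * b / Real.sqrt |θ|) * (b - a) =
      (8 * (b * (b - a) / a ^ 2)) / Real.sqrt |θ| by field_simp]
    refine div_le_div_of_nonneg_right ?_ hθ0.le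
    have : b * (b - a) / a ^ 2 ≤ 2 := by
      rw [div_le_iff₀ (by positivity)]
      nlinarith
    linarith
  calc ‖u b * E b - ∫ x in a..b, u' x * E x‖ ≤ ‖u b * E b‖ + ‖∫ x in a..b, u' x * E x‖ :=
        norm_sub_le _ _
    _ ≤ 8 / Real.sqrt |θ| + 16 / Real.sqrt |θ| := add_le_add h1 (h2.trans h3)
    _ = 24 / Real.sqrt |θ| := by ring

/-- **Dyadic ranges**: for `0 < a ≤ x ≤ 2^K a` and `θ ≠ 0`,
`|∫_a^x v^{-1+iθ} e^{isv} dv| ≤ 24K|θ|^{-1/2}`. [cite: GuthMaynard2026, proof of Lemma 6.2] -/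
theorem norm_integral_oscInt_le_dyadic {θ s a : ℝ} (ha : 0 < a) (hθ : θ ≠ 0) (K : ℕ) :
    ∀ x : ℝ, a ≤ x → x ≤ 2 ^ K * a → ‖∫ v in a..x, oscInt θ s v‖ ≤ 24 * K / Real.sqrt |θ| := by
  induction K with
  | zero =>
    intro x hax hx
    rw [pow_zero, one_mul] at hx
    have : x = a := le_antisymm hx hax
    subst this
    simp
  | succ K ih =>
    intro x hax hx
    have hθ0 : 0 < Real.sqrt |θ| := Real.sqrt_pos.mpr (abs_pos.mpr hθ)
    rcases le_or_gt x (2 ^ K * a) with hle | hgt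
    · refine (ih x hax hle).trans ?_
      refine div_le_div_of_nonneg_right ?_ hθ0.le
      push_cast
      linarith
    · set c : ℝ := 2 ^ K * a with hc
      have hc0 : 0 < c := by positivity
      have hac : a ≤ c := by
        rw [hc]
        have : (1 : ℝ) ≤ 2 ^ K := one_le_pow₀ (by norm_num)
        nlinarith
      have hsplit : ∫ v in a..x, oscInt θ s v =
          (∫ v in a..c, oscInt θ s v) + ∫ v in c..x, oscInt θ s v :=
        (intervalIntegral.integral_add_adjacent_intervals
          (intervalIntegrable_oscInt θ s ha hac)
          (intervalIntegrable_oscInt θ s hc0 hgt.le)).symm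
      rw [hsplit]
      have h1 := ih c hac le_rfl
      have hx2 : x ≤ 2 * c := by rw [hc, pow_succ] at *; linarith
      have h2 : ‖∫ v in c..x, oscInt θ s v‖ ≤ 24 / Real.sqrt |θ| :=
        norm_integral_oscInt_le_block hc0 hgt.le hx2 hθ
      calc ‖(∫ v in a..c, oscInt θ s v) + ∫ v in c..x, oscInt θ s v‖
          ≤ 24 * K / Real.sqrt |θ| + 24 / Real.sqrt |θ| :=
            (norm_add_le _ _).trans (add_le_add h1 h2)
        _ = 24 * (K + 1 : ℕ) / Real.sqrt |θ| := by push_cast; ring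

/-! ## §2. The Mellin transform of `w²` on the line `re s = 1` as a Fourier transform, and Mellin inversion -/

section weight

variable {w : ℝ → ℝ}

/-- `ψ_w(v) = e^v w(e^v)²` as a real function (`expWeight w = ψ_w` as a complex function).
[cite: GuthMaynard2026, proof of Lemma 4.3] -/
def expWeightR (w : ℝ → ℝ) (v : ℝ) : ℝ := Real.exp v * (w (Real.exp v)) ^ 2

/-- `expWeight w` is the complexification of `expWeightR w`. [folklore] -/
theorem expWeight_eq (w : ℝ → ℝ) : expWeight w = fun v ↦ ((expWeightR w v : ℝ) : ℂ) := rfl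

/-- `ψ_w` is smooth. [folklore] -/
theorem expWeightR_contDiff (hw : ContDiff ℝ ∞ w) : ContDiff ℝ ∞ (expWeightR w) :=
  Real.contDiff_exp.mul ((hw.comp Real.contDiff_exp).pow 2)

/-- `ψ_w` has compact support (in `[0, log 2]`). [folklore] -/
theorem hasCompactSupport_expWeightR (hsupp : Function.support w ⊆ Set.Icc 1 2) :
    HasCompactSupport (expWeightR w) := by
  refine HasCompactSupport.of_support_subset_isCompact (isCompact_Icc (a := 0) (b := Real.log 2))
    fun v hv ↦ ?_
  have hv' : v ∈ Function.support (expWeight w) := by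
    rw [Function.mem_support] at hv ⊢
    rw [expWeight_eq]
    show ((expWeightR w v : ℝ) : ℂ) ≠ 0
    exact_mod_cast hv
  exact tsupport_expWeight_subset hsupp (subset_tsupport _ hv')

/-- `H_w(ξ) := ψ̂_w(ξ) = ∫ e^v w(e^v)² e(−ξv) dv = ∫_0^∞ w(u)² u^{-2πiξ} du`, the Mellin transform
`H(s) = ∫_0^∞ w(u)² u^{s-1} du` of the paper at `s = 1 − 2πiξ`. [cite: GuthMaynard2026, proof of Lemma 6.2] -/
def mel (w : ℝ → ℝ) : ℝ → ℂ := 𝓕 (fun v ↦ ((expWeightR w v : ℝ) : ℂ))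

/-- `H_w` is integrable. [folklore] -/
theorem mel_integrable (hw : ContDiff ℝ ∞ w) (hsupp : Function.support w ⊆ Set.Icc 1 2) :
    Integrable (mel w) :=
  integrable_fourier_bump (expWeightR_contDiff hw) (hasCompactSupport_expWeightR hsupp)

/-- `H_w` is continuous. [folklore] -/
theorem mel_continuous (hw : ContDiff ℝ ∞ w) (hsupp : Function.support w ⊆ Set.Icc 1 2) :
    Continuous (mel w) :=
  VectorFourier.fourierIntegral_continuous Real.continuous_fourierChar
    (by exact continuous_inner)
    (integrable_ofReal_bump (expWeightR_contDiff hw) (hasCompactSupport_expWeightR hsupp))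

/-- `|H_w| ≤ K` and `|H_w(ξ)| ≤ K|ξ|^{-j}` ("`H(s) ≪_j |s|^{-j}` … by repeated integration by parts").
[cite: GuthMaynard2026, proof of Lemma 6.2] -/
theorem mel_decay (hw : ContDiff ℝ ∞ w) (hsupp : Function.support w ⊆ Set.Icc 1 2) (j : ℕ) :
    ∃ K, 0 ≤ K ∧ (∀ ξ, ‖mel w ξ‖ ≤ K) ∧ (∀ ξ, ξ ≠ 0 → ‖mel w ξ‖ ≤ K / |ξ| ^ j) :=
  fourier_decay (Complex.ofRealCLM.contDiff.comp (expWeightR_contDiff hw))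
    ((hasCompactSupport_expWeightR hsupp).comp_left Complex.ofReal_zero) j

/-- **Mellin inversion for `w²`** (Fourier inversion for `ψ_w`): for `u > 0`,
`w(u)² = u^{-1} ∫ H_w(ξ) u^{2πiξ} dξ`, i.e. `w(u)² = (2πi)^{-1}∫_{(1)} H(s)u^{-s} ds`.
[cite: GuthMaynard2026, proof of Lemma 6.2] -/
theorem weight_sq_eq_integral (hw : ContDiff ℝ ∞ w) (hsupp : Function.support w ⊆ Set.Icc 1 2)
    {u : ℝ} (hu : 0 < u) :
    ((((w u) ^ 2 : ℝ)) : ℂ) = ((u : ℝ) : ℂ)⁻¹ * ∫ ξ, ((𝐞 (ξ * Real.log u) : ℂ)) * mel w ξ := by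
  have h := bump_eq_integral (expWeightR_contDiff hw) (hasCompactSupport_expWeightR hsupp)
    (Real.log u)
  rw [expWeightR, Real.exp_log hu] at h
  have hu0 : ((u : ℝ) : ℂ) ≠ 0 := by exact_mod_cast hu.ne'
  rw [mel, ← h]
  push_cast
  field_simp

end weight

/-! ## §3. Lemma 6.2 in exact form: `∑_{m ≤ M} ĥ_t(±mN)` as an average of Dirichlet polynomials -/

/-- `ePow a u · ePow b u = ePow (a + b) u`. [folklore] -/
theorem ePow_add_exponent (a b : ℂ) (u : ℝ) : ePow a u * ePow b u = ePow (a + b) u := by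
  rw [ePow, ePow, ePow, ← Complex.exp_add]
  congr 1
  ring

/-- `ePow s u · ePow (−s) u = 1`. [folklore] -/
theorem ePow_mul_ePow_neg (s : ℂ) (u : ℝ) : ePow s u * ePow (-s) u = 1 := by
  rw [ePow_add_exponent, add_neg_cancel, ePow, mul_zero, Complex.exp_zero]

/-- `‖ePow (θ I) u‖ = 1` for `u > 0` and real `θ`. [folklore] -/
theorem norm_ePow_mul_I {u : ℝ} (hu : 0 < u) (θ : ℝ) : ‖ePow (θ * I) u‖ = 1 := by
  rw [norm_ePow hu]
  simp

/-- `‖ePow (−(θ I)) u‖ = 1` for `u > 0` and real `θ`. [folklore] -/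
theorem norm_ePow_neg_mul_I {u : ℝ} (hu : 0 < u) (θ : ℝ) : ‖ePow (-((θ : ℂ) * I)) u‖ = 1 := by
  rw [norm_ePow hu]
  simp

/-- The integrand after Mellin inversion: `Φ(u, ξ) = u^{-1} u^{2πiξ} u^{it} e(−εcu)`. [cite: GuthMaynard2026, proof of Lemma 6.2] -/
def invKernel (t ε c : ℝ) (u ξ : ℝ) : ℂ :=
  ((u : ℝ) : ℂ)⁻¹ * Complex.exp (((2 * π * (ξ * Real.log u) : ℝ) : ℂ) * I) * ePow (t * I) u *
    Complex.exp (((2 * π * (-(u * (ε * c))) : ℝ) : ℂ) * I)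

/-- `|Φ(u, ξ)| = 1/u` for `u > 0`. [folklore] -/
theorem norm_invKernel {t ε c u : ℝ} (hu : 0 < u) (ξ : ℝ) : ‖invKernel t ε c u ξ‖ = u⁻¹ := by
  rw [invKernel, norm_mul, norm_mul, norm_mul, norm_inv, Complex.norm_real, Real.norm_of_nonneg hu.le,
    Complex.norm_exp_ofReal_mul_I, Complex.norm_exp_ofReal_mul_I, norm_ePow_mul_I hu, mul_one, mul_one,
    mul_one]

/-- **The substitution `v = cu`**: for `u, c > 0`,
`u^{-1} u^{2πiξ} u^{it} e(−εcu) = c · c^{-iθ} · (cu)^{-1+iθ} e^{-2πiε(cu)}` with `θ = t + 2πξ`.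
[cite: GuthMaynard2026, proof of Lemma 6.2] -/
theorem invKernel_eq {u c : ℝ} (hu : 0 < u) (hc : 0 < c) (t ε ξ : ℝ) :
    invKernel t ε c u ξ = (c : ℂ) * ePow (-(((t + 2 * π * ξ : ℝ) : ℂ) * I)) c *
      oscInt (t + 2 * π * ξ) (-(2 * π * ε)) (c * u) := by
  have hu0 : ((u : ℝ) : ℂ) ≠ 0 := by exact_mod_cast hu.ne'
  have hc0 : ((c : ℝ) : ℂ) ≠ 0 := by exact_mod_cast hc.ne'
  have hcu : 0 < c * u := mul_pos hc hu
  -- left-hand side as `u⁻¹ exp A`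
  have eL : invKernel t ε c u ξ = ((u : ℝ) : ℂ)⁻¹ *
      Complex.exp (((2 * π * (ξ * Real.log u) : ℝ) : ℂ) * I + (Real.log u : ℂ) * ((t : ℂ) * I) +
        ((2 * π * (-(u * (ε * c))) : ℝ) : ℂ) * I) := by
    rw [invKernel, ePow, Complex.exp_add, Complex.exp_add]
    ring
  -- right-hand side as `u⁻¹ exp B`
  have eR : (c : ℂ) * ePow (-(((t + 2 * π * ξ : ℝ) : ℂ) * I)) c *
      oscInt (t + 2 * π * ξ) (-(2 * π * ε)) (c * u) = ((u : ℝ) : ℂ)⁻¹ *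
      Complex.exp ((Real.log c : ℂ) * (-(((t + 2 * π * ξ : ℝ) : ℂ) * I)) +
        I * ((((t + 2 * π * ξ) * (Real.log c + Real.log u) + (-(2 * π * ε)) * (c * u) : ℝ)) : ℂ)) := by
    rw [oscInt, oscPhase, Real.log_mul hc.ne' hu.ne', ePow, Complex.exp_add]
    push_cast
    field_simp
  rw [eL, eR]
  congr 2
  push_cast
  ring

/-- `J^{s}_{N,M}(θ) := ∫_N^{2MN} v^{-1+iθ} e^{isv} dv` (`s = ∓2π`: the integral
`∫_N^{2NM} v^{-1+i(t-r)} e(∓v) dv` of the paper). [cite: GuthMaynard2026, proof of Lemma 6.2] -/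
def Jint (s N : ℝ) (M : ℕ) (θ : ℝ) : ℂ := ∫ v in N..(2 * M * N), oscInt θ s v

/-- `D_M(θ) := ∑_{m=1}^{M} m^{-iθ}`, the Dirichlet polynomial of Lemma 6.2. [cite: GuthMaynard2026, Lemma 6.2] -/
def dirD (M : ℕ) (θ : ℝ) : ℂ := ∑ m ∈ Finset.Icc 1 M, ePow (-((θ : ℂ) * I)) m

/-- `|D_M(θ)| ≤ M`. [folklore] -/
theorem norm_dirD_le (M : ℕ) (θ : ℝ) : ‖dirD M θ‖ ≤ M := by
  unfold dirD
  refine (norm_sum_le _ _).trans ?_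
  have : ∀ m ∈ Finset.Icc 1 M, ‖ePow (-((θ : ℂ) * I)) m‖ ≤ 1 := by
    intro m hm
    rw [Finset.mem_Icc] at hm
    rw [norm_ePow_neg_mul_I (by exact_mod_cast hm.1)]
  calc ∑ m ∈ Finset.Icc 1 M, ‖ePow (-((θ : ℂ) * I)) m‖ ≤ ∑ m ∈ Finset.Icc 1 M, (1 : ℝ) :=
        Finset.sum_le_sum this
    _ = M := by simp

/-- `|J^{s}_{N,M}(θ)| ≤ log(2M)` (trivial bound). [cite: GuthMaynard2026, proof of Lemma 6.2] -/
theorem norm_Jint_le_log (s : ℝ) {N : ℝ} (hN : 0 < N) {M : ℕ} (hM : 1 ≤ M) (θ : ℝ) :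
    ‖Jint s N M θ‖ ≤ Real.log (2 * M) := by
  have hM1 : (1 : ℝ) ≤ M := by exact_mod_cast hM
  have h := norm_integral_oscInt_le_log θ s hN (b := 2 * M * N) (by nlinarith)
  rw [Jint]
  refine h.trans (le_of_eq ?_)
  congr 1
  field_simp

/-- `|J^{s}_{N,M}(θ)| ≤ 24K|θ|^{-1/2}` whenever `2M ≤ 2^K` and `θ ≠ 0` (second-derivative test on
`K` dyadic blocks). [cite: GuthMaynard2026, proof of Lemma 6.2] -/
theorem norm_Jint_le_dyadic (s : ℝ) {N : ℝ} (hN : 0 < N) {M K : ℕ} (hM : 1 ≤ M)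
    (hK : 2 * (M : ℝ) ≤ 2 ^ K) {θ : ℝ} (hθ : θ ≠ 0) :
    ‖Jint s N M θ‖ ≤ 24 * K / Real.sqrt |θ| := by
  have hM1 : (1 : ℝ) ≤ M := by exact_mod_cast hM
  rw [Jint]
  exact norm_integral_oscInt_le_dyadic hN hθ K (2 * M * N) (by nlinarith) (by nlinarith)

section weight

variable {w : ℝ → ℝ}

/-- Integrability of `(u, ξ) ↦ H_w(ξ) Φ(u, ξ)` on `[a, b] × ℝ` (`0 < a ≤ b`): the integrand is
bounded by `a^{-1}|H_w(ξ)|`. [folklore] -/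
theorem integrable_mel_mul_invKernel (hw : ContDiff ℝ ∞ w) (hsupp : Function.support w ⊆ Set.Icc 1 2)
    (t ε c : ℝ) {a b : ℝ} (ha : 0 < a) (hab : a ≤ b) :
    Integrable (Function.uncurry fun u ξ ↦ mel w ξ * invKernel t ε c u ξ)
      ((volume.restrict (Set.uIoc a b)).prod volume) := by
  rw [Set.uIoc_of_le hab]
  have hg : Integrable (fun z : ℝ × ℝ ↦ (fun _ : ℝ ↦ (a⁻¹ : ℝ)) z.1 * ‖mel w z.2‖)
      ((volume.restrict (Ioc a b)).prod volume) :=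
    (integrable_const (a⁻¹ : ℝ)).mul_prod (mel_integrable hw hsupp).norm
  have hmelm : Measurable (mel w) := (mel_continuous hw hsupp).measurable
  have hFm : Measurable (Function.uncurry fun u ξ ↦ mel w ξ * invKernel t ε c u ξ) := by
    unfold invKernel ePow Function.uncurry
    fun_prop
  refine hg.mono' hFm.aestronglyMeasurable ?_
  have hμ : (volume.restrict (Ioc a b)).prod (volume : Measure ℝ) =
      ((volume : Measure ℝ).prod volume).restrict (Ioc a b ×ˢ Set.univ) := by
    rw [← Measure.prod_restrict, Measure.restrict_univ]
  rw [hμ, ae_restrict_iff' (measurableSet_Ioc.prod MeasurableSet.univ)]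
  refine ae_of_all _ fun z hz ↦ ?_
  rcases z with ⟨u, ξ⟩
  simp only [Set.mem_prod, Set.mem_Ioc, Set.mem_univ, and_true] at hz
  have hu0 : 0 < u := lt_trans ha hz.1
  simp only [Function.uncurry_apply_pair, norm_mul, norm_invKernel hu0]
  rw [mul_comm]
  exact mul_le_mul_of_nonneg_right ((inv_lt_inv₀ hu0 ha).mpr hz.1).le (norm_nonneg _)

/-- The inner `u`-integral after the substitution `v = Nmu`:
`∫_{1/m}^{2M/m} F Φ(u,ξ) du = F (Nm)^{-iθ} J_{N,M}(θ)`, `θ = t + 2πξ`. [cite: GuthMaynard2026, proof of Lemma 6.2] -/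
theorem inner_integral_eq (t ε : ℝ) {N : ℝ} (hN : 0 < N) {M m : ℕ} (hm : 1 ≤ m) (hmM : m ≤ M)
    (ξ : ℝ) (F : ℂ) :
    ∫ u in (m : ℝ)⁻¹..(2 * M / m), F * invKernel t ε (N * m) u ξ =
      F * (ePow (-(((t + 2 * π * ξ : ℝ) : ℂ) * I)) (N * m) *
        Jint (-(2 * π * ε)) N M (t + 2 * π * ξ)) := by
  have hm0 : (0 : ℝ) < m := by exact_mod_cast hm
  have hm1 : (1 : ℝ) ≤ m := by exact_mod_cast hm
  have hmM' : (m : ℝ) ≤ M := by exact_mod_cast hmM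
  have hc : 0 < N * m := mul_pos hN hm0
  have ha : (0 : ℝ) < (m : ℝ)⁻¹ := inv_pos.mpr hm0
  have hab : (m : ℝ)⁻¹ ≤ 2 * M / m := by
    rw [inv_eq_one_div, div_le_div_iff_of_pos_right hm0]; linarith
  set θ : ℝ := t + 2 * π * ξ with hθ
  rw [intervalIntegral.integral_const_mul]
  congr 1
  have h1 : ∫ u in (m : ℝ)⁻¹..(2 * M / m), invKernel t ε (N * m) u ξ =
      ∫ u in (m : ℝ)⁻¹..(2 * M / m), ((N * m : ℝ) : ℂ) * ePow (-((θ : ℂ) * I)) (N * m) *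
        oscInt θ (-(2 * π * ε)) (N * m * u) := by
    refine intervalIntegral.integral_congr fun u hu ↦ ?_
    rw [uIcc_of_le hab] at hu
    exact invKernel_eq (lt_of_lt_of_le ha hu.1) hc t ε ξ
  rw [h1, intervalIntegral.integral_const_mul,
    intervalIntegral.integral_comp_mul_left (oscInt θ (-(2 * π * ε))) hc.ne', Jint]
  have e1 : N * m * (m : ℝ)⁻¹ = N := by field_simp
  have e2 : N * m * (2 * M / m) = 2 * M * N := by field_simp
  rw [e1, e2, Complex.real_smul, Complex.ofReal_inv, mul_mul_mul_comm,
    mul_inv_cancel₀ (by exact_mod_cast hc.ne'), one_mul]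

/-- Integrability in `ξ` of `H_w(ξ) (Nm)^{-iθ_ξ} J_{N,M}(θ_ξ)`. [folklore] -/
theorem integrable_term (hw : ContDiff ℝ ∞ w) (hsupp : Function.support w ⊆ Set.Icc 1 2)
    (t ε : ℝ) {N : ℝ} (hN : 0 < N) {M m : ℕ} (hm : 1 ≤ m) (hmM : m ≤ M) :
    Integrable fun ξ ↦ mel w ξ * (ePow (-(((t + 2 * π * ξ : ℝ) : ℂ) * I)) (N * m) *
      Jint (-(2 * π * ε)) N M (t + 2 * π * ξ)) := by
  have hm0 : (0 : ℝ) < m := by exact_mod_cast hm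
  have hm1 : (1 : ℝ) ≤ m := by exact_mod_cast hm
  have ha : (0 : ℝ) < (m : ℝ)⁻¹ := inv_pos.mpr hm0
  have hab : (m : ℝ)⁻¹ ≤ 2 * M / m := by
    rw [inv_eq_one_div, div_le_div_iff_of_pos_right hm0]
    have : (m : ℝ) ≤ M := by exact_mod_cast hmM
    linarith
  have h := (integrable_mel_mul_invKernel hw hsupp t ε (N * m) ha hab).integral_prod_right
  refine h.congr (ae_of_all _ fun ξ ↦ ?_)
  simp only [Function.uncurry_apply_pair]
  rw [Set.uIoc_of_le hab, ← intervalIntegral.integral_of_le hab]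
  exact inner_integral_eq t ε hN hm hmM ξ (mel w ξ)

/-- **Lemma 6.2, one frequency.** For `1 ≤ m ≤ M`, `N > 0` and real `ε`,
`ĥ_t(εNm) = ∫ H_w(ξ) (Nm)^{-iθ} J^{-2πε}_{N,M}(θ) dξ` with `θ = t + 2πξ`
(Mellin inversion, Fubini on `[1/m, 2M/m] × ℝ`, and the substitution `v = Nmu`).
[cite: GuthMaynard2026, Lemma 6.2 (proof)] -/
theorem fourier_hFun_eq (hw : ContDiff ℝ ∞ w) (hsupp : Function.support w ⊆ Set.Icc 1 2)
    (t ε : ℝ) {N : ℝ} (hN : 0 < N) {M m : ℕ} (hm : 1 ≤ m) (hmM : m ≤ M) :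
    𝓕 (hFun w t) (ε * (N * m)) = ∫ ξ, mel w ξ * (ePow (-(((t + 2 * π * ξ : ℝ) : ℂ) * I)) (N * m) *
      Jint (-(2 * π * ε)) N M (t + 2 * π * ξ)) := by
  have hm0 : (0 : ℝ) < m := by exact_mod_cast hm
  have hm1 : (1 : ℝ) ≤ m := by exact_mod_cast hm
  have hmM' : (m : ℝ) ≤ M := by exact_mod_cast hmM
  set c : ℝ := N * m with hc
  have hc0 : 0 < c := mul_pos hN hm0
  set a : ℝ := (m : ℝ)⁻¹ with ha
  set b : ℝ := 2 * M / m with hb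
  have ha0 : 0 < a := inv_pos.mpr hm0
  have hab : a ≤ b := by
    rw [ha, hb, inv_eq_one_div, div_le_div_iff_of_pos_right hm0]; linarith
  have hIcc : Set.Icc (1 : ℝ) 2 ⊆ Set.Icc a b := by
    refine Set.Icc_subset_Icc ?_ ?_
    · rw [ha]; exact inv_le_one_of_one_le₀ (by exact_mod_cast hm)
    · rw [hb, le_div_iff₀ hm0]; linarith
  -- Step 1: restrict the Fourier integral to `[a, b]`
  have h1 : 𝓕 (hFun w t) (ε * c) = ∫ u in a..b, 𝐞 (-(u * (ε * c))) • hFun w t u := by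
    rw [Real.fourier_real_eq, ← setIntegral_eq_integral_of_forall_compl_eq_zero (s := Set.Icc a b),
      integral_Icc_eq_integral_Ioc, intervalIntegral.integral_of_le hab]
    intro u hu
    rw [hFun_eq_zero_of_notMem hsupp t (fun h ↦ hu (hIcc h)), smul_zero]
  -- Step 2: Mellin inversion inside
  have h2 : ∫ u in a..b, 𝐞 (-(u * (ε * c))) • hFun w t u =
      ∫ u in a..b, ∫ ξ, mel w ξ * invKernel t ε c u ξ := by
    refine intervalIntegral.integral_congr fun u hu ↦ ?_
    rw [uIcc_of_le hab] at hu
    have hu0 : 0 < u := lt_of_lt_of_le ha0 hu.1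
    rw [Circle.smul_def, smul_eq_mul,
      show hFun w t u = ((((w u) ^ 2 : ℝ)) : ℂ) * ePow (t * I) u from rfl,
      weight_sq_eq_integral hw hsupp hu0]
    rw [← integral_const_mul, ← integral_mul_const, ← integral_const_mul]
    refine integral_congr_ae (ae_of_all _ fun ξ ↦ ?_)
    simp only [invKernel, Real.fourierChar_apply]
    push_cast
    ring
  -- Step 3: Fubini
  have h3 : ∫ u in a..b, ∫ ξ, mel w ξ * invKernel t ε c u ξ =
      ∫ ξ, ∫ u in a..b, mel w ξ * invKernel t ε c u ξ :=
    intervalIntegral_integral_swap (integrable_mel_mul_invKernel hw hsupp t ε c ha0 hab)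
  rw [h1, h2, h3]
  refine integral_congr_ae (ae_of_all _ fun ξ ↦ ?_)
  exact inner_integral_eq t ε hN hm hmM ξ (mel w ξ)

/-- **Lemma 6.2 (Approximate functional equation), exact form.** For `N > 0`, `M ∈ ℕ` and real
`t, ε`,
`∑_{m=1}^{M} ĥ_t(εNm) = ∫ H_w(ξ) N^{-iθ} D_M(θ) J^{-2πε}_{N,M}(θ) dξ`, `θ = t + 2πξ`,
where `D_M(θ) = ∑_{m ≤ M} m^{-iθ}` and `J_{N,M}(θ) = ∫_N^{2NM} v^{-1+iθ} e(−εv) dv`: "values of a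
Dirichlet polynomial of length `N` at `t ∈ [T,2T]` are determined by values of a Dirichlet polynomial
of length `T/N`". (The paper's `r` is `−2πξ`.) [cite: GuthMaynard2026, Lemma 6.2] -/
theorem sum_fourier_hFun_eq (hw : ContDiff ℝ ∞ w) (hsupp : Function.support w ⊆ Set.Icc 1 2)
    (t ε : ℝ) {N : ℝ} (hN : 0 < N) (M : ℕ) :
    ∑ m ∈ Finset.Icc 1 M, 𝓕 (hFun w t) (ε * (N * m)) =
      ∫ ξ, mel w ξ * (ePow (-(((t + 2 * π * ξ : ℝ) : ℂ) * I)) N * dirD M (t + 2 * π * ξ) *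
        Jint (-(2 * π * ε)) N M (t + 2 * π * ξ)) := by
  have hterm : ∀ m ∈ Finset.Icc 1 M, 𝓕 (hFun w t) (ε * (N * m)) =
      ∫ ξ, mel w ξ * (ePow (-(((t + 2 * π * ξ : ℝ) : ℂ) * I)) (N * m) *
        Jint (-(2 * π * ε)) N M (t + 2 * π * ξ)) := by
    intro m hm
    rw [Finset.mem_Icc] at hm
    exact fourier_hFun_eq hw hsupp t ε hN hm.1 hm.2
  rw [Finset.sum_congr rfl hterm, ← integral_finsetSum]
  · refine integral_congr_ae (ae_of_all _ fun ξ ↦ ?_)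
    simp only
    rw [dirD, Finset.mul_sum, Finset.sum_mul, Finset.mul_sum]
    refine Finset.sum_congr rfl fun m hm ↦ ?_
    rw [Finset.mem_Icc] at hm
    rw [ePow_mul hN (by exact_mod_cast hm.1)]
  · intro m hm
    rw [Finset.mem_Icc] at hm
    exact integrable_term hw hsupp t ε hN hm.1 hm.2

end weight

/-! ## §4. Bounds: truncation of `B_N`, the tail of `H_w`, and the pointwise form of Lemma 6.2 -/

section weight

variable {w : ℝ → ℝ}

/-- `B_N(τ) = ∑_{n ≥ 1} (ĥ_τ(Nn) + ĥ_τ(−Nn))` as a series over `ℕ`. [folklore] -/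
theorem coefB_eq_tsum_nat (hw : ContDiff ℝ ∞ w) (hsupp : Function.support w ⊆ Set.Icc 1 2)
    (τ : ℝ) {N : ℝ} (hN : 1 ≤ N) :
    coefB w N τ = ∑' n : ℕ, (𝓕 (hFun w τ) (N * ((n : ℝ) + 1)) + 𝓕 (hFun w τ) (-(N * ((n : ℝ) + 1)))) := by
  classical
  obtain ⟨C, hC0, hC⟩ := norm_fourier_hFun_le_pow_div hw hsupp 2
  have hN0 : 0 < N := by linarith
  set g : ℤ → ℂ := fun m ↦ if m = 0 then 0 else 𝓕 (hFun w τ) (N * m) with hg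
  -- summability of `g` (as in `norm_coefB_le`)
  have hZs := Real.summable_abs_int_rpow one_lt_two
  have hgs : Summable g := by
    refine Summable.of_norm_bounded (hZs.mul_left (C * (1 + |τ|) ^ 2 / N ^ 2)) fun m ↦ ?_
    simp only [hg]
    split_ifs with hm
    · rw [norm_zero]; positivity
    · have hm1 : 1 ≤ |(m : ℝ)| := by
        rw [← Int.cast_abs]; exact_mod_cast Int.one_le_abs hm
      have h1 := hC τ (N * m) (mul_ne_zero hN0.ne' (by exact_mod_cast hm))
      rw [abs_mul, abs_of_pos hN0, mul_pow] at h1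
      refine h1.trans (le_of_eq ?_)
      rw [Real.rpow_neg (abs_nonneg _), show (2 : ℝ) = (2 : ℕ) by norm_num, Real.rpow_natCast]
      field_simp
  have h := tsum_nat_add_neg hgs
  rw [coefB]
  have hg0 : g 0 = 0 := by simp [hg]
  rw [hg0, add_zero] at h
  rw [← h]
  -- shift the `ℕ`-series by one (`n = 0` term vanishes)
  have hgs' : Summable fun n : ℕ ↦ g n + g (-n) := hgs.nat_add_neg
  rw [hgs'.tsum_eq_zero_add]
  simp only [Nat.cast_zero, neg_zero, hg0, add_zero, zero_add]
  refine tsum_congr fun n ↦ ?_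
  have hn : ((n + 1 : ℕ) : ℤ) ≠ 0 := by omega
  have hn' : -((n + 1 : ℕ) : ℤ) ≠ 0 := by omega
  simp only [hg, hn, hn', if_false]
  push_cast
  ring_nf

/-- `∑_{i ≥ 0} (i+1)^{-2} < ∞`. [folklore] -/
theorem summable_inv_succ_sq : Summable fun i : ℕ ↦ ((i : ℝ) + 1)⁻¹ ^ 2 := by
  have h := (summable_nat_add_iff 1).mpr (Real.summable_nat_pow_inv.mpr one_lt_two)
  refine h.congr fun i ↦ ?_
  push_cast
  rw [inv_pow]

/-- **Truncation of `B_N`**: for `j ≥ 2`, `N ≥ 1`, `M ≥ 1`,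
`|B_N(τ) − ∑_{m=1}^{M} (ĥ_τ(Nm) + ĥ_τ(−Nm))| ≪_j (1+|τ|)^j N^{-j} M^{2-j}`: the terms with
`|m| > M` are `≪_j (1+|τ|)^j (N|m|)^{-j}` by Lemma 4.3 ("`ĥ_t(mN) ≪_ε T^{-100}m^{-2}` unless
`|m| ⪅ T₀/N`"). [cite: GuthMaynard2026, proof of Lemma 6.2] -/
theorem norm_coefB_sub_sum_le (hw : ContDiff ℝ ∞ w) (hsupp : Function.support w ⊆ Set.Icc 1 2)
    {j : ℕ} (hj : 2 ≤ j) : ∃ C, 0 ≤ C ∧ ∀ (τ N : ℝ), 1 ≤ N → ∀ M : ℕ, 1 ≤ M →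
      ‖coefB w N τ - ∑ m ∈ Finset.Icc 1 M, (𝓕 (hFun w τ) (N * m) + 𝓕 (hFun w τ) (-(N * m)))‖ ≤
        C * (1 + |τ|) ^ j / (N ^ j * (M : ℝ) ^ (j - 2)) := by
  obtain ⟨C, hC0, hC⟩ := norm_fourier_hFun_le_pow_div hw hsupp j
  set Z : ℝ := ∑' i : ℕ, ((i : ℝ) + 1)⁻¹ ^ 2 with hZ
  have hZ0 : 0 ≤ Z := tsum_nonneg fun i ↦ by positivity
  refine ⟨2 * C * Z, by positivity, fun τ N hN M hM ↦ ?_⟩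
  have hN0 : 0 < N := by linarith
  have hM0 : (0 : ℝ) < M := by exact_mod_cast hM
  set F : ℕ → ℂ := fun n ↦ 𝓕 (hFun w τ) (N * ((n : ℝ) + 1)) + 𝓕 (hFun w τ) (-(N * ((n : ℝ) + 1)))
    with hF
  -- summability of `F` and the bound on its terms
  have hFb : ∀ n : ℕ, ‖F n‖ ≤ 2 * C * (1 + |τ|) ^ j / (N ^ j * ((n : ℝ) + 1) ^ j) := by
    intro n
    have hn0 : (0 : ℝ) < (n : ℝ) + 1 := by positivity
    have hx : N * ((n : ℝ) + 1) ≠ 0 := by positivity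
    have h1 := hC τ (N * ((n : ℝ) + 1)) hx
    have h2 := hC τ (-(N * ((n : ℝ) + 1))) (neg_ne_zero.mpr hx)
    rw [abs_neg] at h2
    rw [abs_mul, abs_of_pos hN0, abs_of_pos hn0, mul_pow] at h1 h2
    calc ‖F n‖ ≤ ‖𝓕 (hFun w τ) (N * ((n : ℝ) + 1))‖ + ‖𝓕 (hFun w τ) (-(N * ((n : ℝ) + 1)))‖ :=
          norm_add_le _ _
      _ ≤ C * (1 + |τ|) ^ j / (N ^ j * ((n : ℝ) + 1) ^ j) +
          C * (1 + |τ|) ^ j / (N ^ j * ((n : ℝ) + 1) ^ j) := add_le_add h1 h2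
      _ = _ := by ring
  have hFs : Summable F := by
    refine Summable.of_norm_bounded ((summable_inv_succ_sq).mul_left (2 * C * (1 + |τ|) ^ j / N ^ j))
      fun n ↦ (hFb n).trans ?_
    have hn1 : (1 : ℝ) ≤ (n : ℝ) + 1 := by
      have : (0 : ℝ) ≤ n := Nat.cast_nonneg n
      linarith
    rw [inv_pow, ← div_eq_mul_inv, div_div]
    refine div_le_div_of_nonneg_left (by positivity) (by positivity) ?_
    exact mul_le_mul_of_nonneg_left (pow_le_pow_right₀ hn1 hj) (by positivity)
  -- split the series at `M`
  rw [coefB_eq_tsum_nat hw hsupp τ hN, ← Summable.sum_add_tsum_nat_add M hFs]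
  have hfin : ∑ i ∈ Finset.range M, F i =
      ∑ m ∈ Finset.Icc 1 M, (𝓕 (hFun w τ) (N * m) + 𝓕 (hFun w τ) (-(N * m))) := by
    rw [← Finset.Ico_add_one_right_eq_Icc, Finset.sum_Ico_eq_sum_range, Nat.add_sub_cancel]
    refine Finset.sum_congr rfl fun i _ ↦ ?_
    simp only [hF]
    push_cast
    ring_nf
  rw [hfin, add_sub_cancel_left]
  -- the tail
  have htail : ∀ i : ℕ, ‖F (i + M)‖ ≤
      2 * C * (1 + |τ|) ^ j / (N ^ j * (M : ℝ) ^ (j - 2)) * ((i : ℝ) + 1)⁻¹ ^ 2 := by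
    intro i
    refine (hFb (i + M)).trans ?_
    have hi0 : (0 : ℝ) ≤ i := Nat.cast_nonneg i
    have hM1 : (1 : ℝ) ≤ M := by exact_mod_cast hM
    have hkey : (M : ℝ) ^ (j - 2) * ((i : ℝ) + 1) ^ 2 ≤ (((i + M : ℕ) : ℝ) + 1) ^ j := by
      have e : j = (j - 2) + 2 := by omega
      conv_rhs => rw [e, pow_add]
      push_cast
      refine mul_le_mul (pow_le_pow_left₀ hM0.le (by linarith) _)
        (pow_le_pow_left₀ (by positivity) (by linarith) 2) (by positivity) (by positivity)
    rw [inv_pow, mul_comm (2 * C * (1 + |τ|) ^ j / (N ^ j * (M : ℝ) ^ (j - 2))),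
      ← div_eq_inv_mul, div_div]
    refine div_le_div_of_nonneg_left (by positivity) (by positivity) ?_
    calc N ^ j * (M : ℝ) ^ (j - 2) * ((i : ℝ) + 1) ^ 2 = N ^ j * ((M : ℝ) ^ (j - 2) * ((i : ℝ) + 1) ^ 2) := by
          ring
      _ ≤ N ^ j * (((i + M : ℕ) : ℝ) + 1) ^ j := mul_le_mul_of_nonneg_left hkey (by positivity)
  refine (tsum_of_norm_bounded ((summable_inv_succ_sq).hasSum.mul_left
    (2 * C * (1 + |τ|) ^ j / (N ^ j * (M : ℝ) ^ (j - 2)))) htail).trans (le_of_eq ?_)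
  rw [← hZ]
  ring

/-- **The tail of `H_w`**: `∫_{|ξ| ≥ X} |H_w(ξ)| dξ ≪_j X^{-j}` for `X > 0` (from `|H_w(ξ)| ≪ |ξ|^{-j-2}`).
[cite: GuthMaynard2026, proof of Lemma 6.2] -/
theorem integral_indicator_norm_mel_le (hw : ContDiff ℝ ∞ w)
    (hsupp : Function.support w ⊆ Set.Icc 1 2) (j : ℕ) : ∃ C, 0 ≤ C ∧ ∀ X : ℝ, 0 < X →
      ∫ ξ, Set.indicator {ξ : ℝ | X ≤ |ξ|} (fun ξ ↦ ‖mel w ξ‖) ξ ≤ C / X ^ j := by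
  obtain ⟨K, hK0, -, hK⟩ := mel_decay hw hsupp (j + 2)
  have hmi := mel_integrable hw hsupp
  set L : ℝ := ∫ ξ, ‖mel w ξ‖ with hL
  have hL0 : 0 ≤ L := integral_nonneg fun _ ↦ norm_nonneg _
  refine ⟨max (2 * K * π) L, le_max_of_le_right hL0, fun X hX ↦ ?_⟩
  have hmeas : MeasurableSet {ξ : ℝ | X ≤ |ξ|} :=
    measurableSet_le measurable_const continuous_abs.measurable
  -- the indicator is bounded by the whole integral
  have hle_L : ∫ ξ, Set.indicator {ξ : ℝ | X ≤ |ξ|} (fun ξ ↦ ‖mel w ξ‖) ξ ≤ L := by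
    rw [hL]
    refine integral_mono_of_nonneg (ae_of_all _ fun ξ ↦ ?_) hmi.norm (ae_of_all _ fun ξ ↦ ?_)
    · exact Set.indicator_nonneg (fun _ _ ↦ norm_nonneg _) _
    · exact Set.indicator_le_self' (fun _ _ ↦ norm_nonneg _) ξ
  rcases lt_or_ge X 1 with hX1 | hX1
  · -- `X < 1`: `L ≤ max(…, L) ≤ max(…, L)/X^j`
    refine hle_L.trans ?_
    calc L ≤ max (2 * K * π) L := le_max_right _ _
      _ ≤ max (2 * K * π) L / X ^ j := by
          rw [le_div_iff₀ (pow_pos hX j)]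
          exact mul_le_of_le_one_right (le_max_of_le_right hL0) (pow_le_one₀ hX.le hX1.le)
  · -- `X ≥ 1`: pointwise `1_{|ξ|≥X}|H_w(ξ)| ≤ 2K X^{-j} (1+ξ²)^{-1}`
    have hpt : ∀ ξ : ℝ, Set.indicator {ξ : ℝ | X ≤ |ξ|} (fun ξ ↦ ‖mel w ξ‖) ξ ≤
        2 * K / X ^ j * (1 + ξ ^ 2)⁻¹ := by
      intro ξ
      by_cases hξ : ξ ∈ {ξ : ℝ | X ≤ |ξ|}
      · rw [Set.indicator_of_mem hξ]
        simp only [Set.mem_setOf_eq] at hξ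
        have hξ1 : 1 ≤ |ξ| := hX1.trans hξ
        have hξ0 : ξ ≠ 0 := by intro h; rw [h, abs_zero] at hξ1; linarith
        refine (hK ξ hξ0).trans ?_
        rw [pow_add, div_le_iff₀ (by positivity)]
        have hξ2 : 1 ≤ ξ ^ 2 := by rw [← sq_abs]; exact one_le_pow₀ hξ1
        have h1 : (1 + ξ ^ 2) ≤ 2 * |ξ| ^ 2 := by rw [sq_abs]; linarith
        have h2 : X ^ j ≤ |ξ| ^ j := pow_le_pow_left₀ hX.le hξ j
        calc K = K * X ^ j * (X ^ j)⁻¹ := by field_simp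
          _ ≤ K * |ξ| ^ j * (X ^ j)⁻¹ := by gcongr
          _ = 2 * K / X ^ j * (2 * |ξ| ^ 2)⁻¹ * (|ξ| ^ j * |ξ| ^ 2) := by field_simp
          _ ≤ 2 * K / X ^ j * (1 + ξ ^ 2)⁻¹ * (|ξ| ^ j * |ξ| ^ 2) := by
              gcongr
      · rw [Set.indicator_of_notMem hξ]
        positivity
    calc ∫ ξ, Set.indicator {ξ : ℝ | X ≤ |ξ|} (fun ξ ↦ ‖mel w ξ‖) ξ
        ≤ ∫ ξ : ℝ, 2 * K / X ^ j * (1 + ξ ^ 2)⁻¹ := by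
          refine integral_mono_of_nonneg (ae_of_all _ fun ξ ↦ ?_)
            (integrable_inv_one_add_sq.const_mul _) (ae_of_all _ hpt)
          exact Set.indicator_nonneg (fun _ _ ↦ norm_nonneg _) _
      _ = 2 * K * π / X ^ j := by
          rw [integral_const_mul, integral_univ_inv_one_add_sq]; ring
      _ ≤ max (2 * K * π) L / X ^ j := by
          gcongr
          exact le_max_left _ _

/-- `D_M` is continuous. [folklore] -/
theorem continuous_dirD (M : ℕ) : Continuous (dirD M) := by
  unfold dirD ePow
  fun_prop

/-- **Lemma 6.2 (Approximate functional equation), pointwise bound.** For `N > 0`, `1 ≤ M`,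
`2M ≤ 2^K`, `τ ≠ 0` and `ε ∈ ℝ`:
`|∑_{m=1}^{M} ĥ_τ(εNm)| ≤ 24√2·K|τ|^{-1/2} ∫ |H_w(ξ)| |D_M(τ+2πξ)| dξ + M log(2M) ∫_{|ξ| ≥ |τ|/4π} |H_w(ξ)| dξ`
("`|∑_{m≠0} ĥ_t(mN)| ≪ T₀^{-1/2} ∫_{|u| ⪅ 1} |∑_{m ⪅ T₀/N} m^{-i(t+u)}| du + O(T^{-100})`" for
`|t| ∼ T₀`; here the weight `|H_w|` is kept in the integral and the second term is the part
`|r| ≫ T₀` of the `r`-integral). [cite: GuthMaynard2026, Lemma 6.2] -/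
theorem norm_sum_fourier_hFun_le (hw : ContDiff ℝ ∞ w) (hsupp : Function.support w ⊆ Set.Icc 1 2)
    (ε : ℝ) {N : ℝ} (hN : 0 < N) {M K : ℕ} (hM : 1 ≤ M) (hK : 2 * (M : ℝ) ≤ 2 ^ K) {τ : ℝ}
    (hτ : τ ≠ 0) :
    ‖∑ m ∈ Finset.Icc 1 M, 𝓕 (hFun w τ) (ε * (N * m))‖ ≤
      24 * Real.sqrt 2 * K / Real.sqrt |τ| * (∫ ξ, ‖mel w ξ‖ * ‖dirD M (τ + 2 * π * ξ)‖) +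
        M * Real.log (2 * M) *
          ∫ ξ, Set.indicator {ξ : ℝ | |τ| / (4 * π) ≤ |ξ|} (fun ξ ↦ ‖mel w ξ‖) ξ := by
  have hmi := mel_integrable hw hsupp
  have hM1 : (1 : ℝ) ≤ M := by exact_mod_cast hM
  have hlog0 : 0 ≤ Real.log (2 * M) := Real.log_nonneg (by linarith)
  have hτ0 : 0 < |τ| := abs_pos.mpr hτ
  have hsτ : 0 < Real.sqrt |τ| := Real.sqrt_pos.mpr hτ0
  set S : Set ℝ := {ξ : ℝ | |τ| / (4 * π) ≤ |ξ|} with hS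
  have hSm : MeasurableSet S := measurableSet_le measurable_const continuous_abs.measurable
  set A : ℝ := 24 * Real.sqrt 2 * K / Real.sqrt |τ| with hA
  have hA0 : 0 ≤ A := by positivity
  -- the two majorants
  set g₁ : ℝ → ℝ := fun ξ ↦ A * (‖mel w ξ‖ * ‖dirD M (τ + 2 * π * ξ)‖) with hg₁
  set g₂ : ℝ → ℝ := fun ξ ↦ (M * Real.log (2 * M)) * S.indicator (fun ξ ↦ ‖mel w ξ‖) ξ with hg₂
  have hDc : Continuous fun ξ : ℝ ↦ ‖dirD M (τ + 2 * π * ξ)‖ :=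
    ((continuous_dirD M).comp (continuous_const.add (continuous_const.mul continuous_id))).norm
  have hg₁i : Integrable g₁ := by
    refine (hmi.norm.mul_bdd (c := (M : ℝ)) hDc.aestronglyMeasurable
      (ae_of_all _ fun ξ ↦ ?_)).const_mul A
    rw [Real.norm_eq_abs, abs_of_nonneg (norm_nonneg _)]
    exact norm_dirD_le M _
  have hg₂i : Integrable g₂ := (hmi.norm.indicator hSm).const_mul _
  rw [sum_fourier_hFun_eq hw hsupp τ ε hN M]
  have hbound : ∀ ξ : ℝ, ‖mel w ξ * (ePow (-(((τ + 2 * π * ξ : ℝ) : ℂ) * I)) N *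
      dirD M (τ + 2 * π * ξ) * Jint (-(2 * π * ε)) N M (τ + 2 * π * ξ))‖ ≤ g₁ ξ + g₂ ξ := by
    intro ξ
    rw [norm_mul, norm_mul, norm_mul, norm_ePow_neg_mul_I hN, one_mul]
    by_cases hξ : ξ ∈ S
    · -- `|ξ| ≥ |τ|/4π`: trivial bounds
      have h1 : ‖dirD M (τ + 2 * π * ξ)‖ * ‖Jint (-(2 * π * ε)) N M (τ + 2 * π * ξ)‖ ≤
          M * Real.log (2 * M) :=
        mul_le_mul (norm_dirD_le M _) (norm_Jint_le_log _ hN hM _) (norm_nonneg _) (Nat.cast_nonneg M)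
      have h2 : g₂ ξ = M * Real.log (2 * M) * ‖mel w ξ‖ := by
        simp only [hg₂, Set.indicator_of_mem hξ]
      have h3 : 0 ≤ g₁ ξ := by simp only [hg₁]; positivity
      calc ‖mel w ξ‖ * (‖dirD M (τ + 2 * π * ξ)‖ * ‖Jint (-(2 * π * ε)) N M (τ + 2 * π * ξ)‖)
          ≤ ‖mel w ξ‖ * (M * Real.log (2 * M)) := mul_le_mul_of_nonneg_left h1 (norm_nonneg _)
        _ = g₂ ξ := by rw [h2]; ring
        _ ≤ g₁ ξ + g₂ ξ := by linarith
    · -- `|ξ| < |τ|/4π`: `|θ| ≥ |τ|/2`, second-derivative test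
      have hξ' : |ξ| < |τ| / (4 * π) := by
        simp only [hS, Set.mem_setOf_eq, not_le] at hξ; exact hξ
      have hθ : |τ| / 2 ≤ |τ + 2 * π * ξ| := by
        have h1 : |2 * π * ξ| ≤ |τ| / 2 := by
          rw [abs_mul, abs_of_pos (by positivity : (0 : ℝ) < 2 * π)]
          have := Real.pi_pos
          calc 2 * π * |ξ| ≤ 2 * π * (|τ| / (4 * π)) := by gcongr
            _ = |τ| / 2 := by field_simp; ring
        have h2 := abs_sub_abs_le_abs_sub τ (-(2 * π * ξ))
        rw [abs_neg, sub_neg_eq_add] at h2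
        linarith
      have hθ0 : τ + 2 * π * ξ ≠ 0 := by
        intro h; rw [h, abs_zero] at hθ; linarith
      have hJ := norm_Jint_le_dyadic (-(2 * π * ε)) hN hM hK hθ0
      have hsq : Real.sqrt |τ| ≤ Real.sqrt 2 * Real.sqrt |τ + 2 * π * ξ| := by
        rw [← Real.sqrt_mul zero_le_two]
        exact Real.sqrt_le_sqrt (by linarith)
      have hJ' : ‖Jint (-(2 * π * ε)) N M (τ + 2 * π * ξ)‖ ≤ A := by
        refine hJ.trans ?_
        rw [hA, div_le_div_iff₀ (Real.sqrt_pos.mpr (abs_pos.mpr hθ0)) hsτ]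
        calc 24 * (K : ℝ) * Real.sqrt |τ| ≤ 24 * K * (Real.sqrt 2 * Real.sqrt |τ + 2 * π * ξ|) := by
              gcongr
          _ = 24 * Real.sqrt 2 * K * Real.sqrt |τ + 2 * π * ξ| := by ring
      have h3 : 0 ≤ g₂ ξ := by
        simp only [hg₂, Set.indicator_of_notMem hξ, mul_zero]; rfl
      calc ‖mel w ξ‖ * (‖dirD M (τ + 2 * π * ξ)‖ * ‖Jint (-(2 * π * ε)) N M (τ + 2 * π * ξ)‖)
          ≤ ‖mel w ξ‖ * (‖dirD M (τ + 2 * π * ξ)‖ * A) := by gcongr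
        _ = g₁ ξ := by simp only [hg₁]; ring
        _ ≤ g₁ ξ + g₂ ξ := by linarith
  refine (norm_integral_le_of_norm_le (hg₁i.add hg₂i) (ae_of_all _ hbound)).trans (le_of_eq ?_)
  rw [integral_add' hg₁i hg₂i]
  simp only [hg₁, hg₂]
  rw [integral_const_mul, integral_const_mul]

end weight

/-! ## §5. Squares, and the mean square of `B_N` over a dyadic class of differences -/

/-- **Cauchy–Schwarz** in the form `(∫ f g)² ≤ (∫ f)(∫ f g²)` for `f, g ≥ 0`. [folklore] -/
theorem sq_integral_mul_le {f g : ℝ → ℝ} (hf : ∀ x, 0 ≤ f x) (hg : ∀ x, 0 ≤ g x)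
    (hfi : Integrable f) (hgm : AEStronglyMeasurable g)
    (hfg2 : Integrable (fun x ↦ f x * g x ^ 2)) :
    (∫ x, f x * g x) ^ 2 ≤ (∫ x, f x) * ∫ x, f x * g x ^ 2 := by
  have htwo : ENNReal.ofReal (2 : ℝ) = 2 := by simp
  have hsm : AEStronglyMeasurable (fun x ↦ Real.sqrt (f x)) :=
    Real.continuous_sqrt.comp_aestronglyMeasurable hfi.aestronglyMeasurable
  have hF : MemLp (fun x ↦ Real.sqrt (f x)) (ENNReal.ofReal 2) := by
    rw [htwo, memLp_two_iff_integrable_sq hsm]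
    refine hfi.congr (ae_of_all _ fun x ↦ ?_)
    simp only [Real.sq_sqrt (hf x)]
  have hsm2 : AEStronglyMeasurable (fun x ↦ Real.sqrt (f x) * g x) := hsm.mul hgm
  have hG : MemLp (fun x ↦ Real.sqrt (f x) * g x) (ENNReal.ofReal 2) := by
    rw [htwo, memLp_two_iff_integrable_sq hsm2]
    refine hfg2.congr (ae_of_all _ fun x ↦ ?_)
    simp only [mul_pow, Real.sq_sqrt (hf x)]
  have h := integral_mul_le_Lp_mul_Lq_of_nonneg (μ := volume) Real.HolderConjugate.two_two
    (ae_of_all _ fun x ↦ Real.sqrt_nonneg (f x))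
    (ae_of_all _ fun x ↦ mul_nonneg (Real.sqrt_nonneg (f x)) (hg x)) hF hG
  have e1 : ∫ x, Real.sqrt (f x) * (Real.sqrt (f x) * g x) = ∫ x, f x * g x :=
    integral_congr_ae (ae_of_all _ fun x ↦ by
      simp only; rw [← mul_assoc, Real.mul_self_sqrt (hf x)])
  have e2 : ∫ x, Real.sqrt (f x) ^ (2 : ℝ) = ∫ x, f x :=
    integral_congr_ae (ae_of_all _ fun x ↦ by
      simp only; rw [Real.rpow_two, Real.sq_sqrt (hf x)])
  have e3 : ∫ x, (Real.sqrt (f x) * g x) ^ (2 : ℝ) = ∫ x, f x * g x ^ 2 :=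
    integral_congr_ae (ae_of_all _ fun x ↦ by
      simp only; rw [Real.rpow_two, mul_pow, Real.sq_sqrt (hf x)])
  rw [e1, e2, e3] at h
  have hA : 0 ≤ ∫ x, f x := integral_nonneg hf
  have hB : 0 ≤ ∫ x, f x * g x ^ 2 := integral_nonneg fun x ↦ by have := hf x; positivity
  have h0 : 0 ≤ ∫ x, f x * g x := integral_nonneg fun x ↦ mul_nonneg (hf x) (hg x)
  calc (∫ x, f x * g x) ^ 2
      ≤ ((∫ x, f x) ^ (1 / (2 : ℝ)) * (∫ x, f x * g x ^ 2) ^ (1 / (2 : ℝ))) ^ 2 :=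
        pow_le_pow_left₀ h0 h 2
    _ = (∫ x, f x) * ∫ x, f x * g x ^ 2 := by
        rw [mul_pow, ← Real.rpow_natCast ((∫ x, f x) ^ (1 / (2 : ℝ))),
          ← Real.rpow_natCast ((∫ x, f x * g x ^ 2) ^ (1 / (2 : ℝ))), ← Real.rpow_mul hA,
          ← Real.rpow_mul hB]
        norm_num

/-- `D_M(t − t' + 2πξ) = ∑_{m ≤ M} m^{-2πiξ} · m^{i(t'−t)}`: on differences, `D_M(· + 2πξ)` is a
Dirichlet polynomial with unimodular coefficients, the form to which Heath-Brown's theorem applies.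
[cite: GuthMaynard2026, (6.2)] -/
theorem dirD_sub_add (M : ℕ) (t t' ξ : ℝ) :
    dirD M (t - t' + 2 * π * ξ) = ∑ m ∈ Finset.Icc 1 M,
      ePow (-(((2 * π * ξ : ℝ) : ℂ) * I)) m * (m : ℂ) ^ (((t' - t : ℝ) : ℂ) * I) := by
  unfold dirD
  refine Finset.sum_congr rfl fun m hm ↦ ?_
  rw [Finset.mem_Icc] at hm
  have hm0 : (0 : ℝ) < m := by exact_mod_cast hm.1
  have e := ePow_eq_cpow hm0 (((t' - t : ℝ) : ℂ) * I)
  rw [Complex.ofReal_natCast] at e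
  rw [← e, ePow_add_exponent]
  congr 1
  push_cast
  ring

/-- `‖m^{-2πiξ}‖ = 1` (`m ≥ 1`). [folklore] -/
theorem norm_ePow_coeff {m : ℕ} (hm : 1 ≤ m) (ξ : ℝ) :
    ‖ePow (-(((2 * π * ξ : ℝ) : ℂ) * I)) m‖ = 1 :=
  norm_ePow_neg_mul_I (by exact_mod_cast hm) _

section weight

variable {w : ℝ → ℝ}

/-- **`B_N(τ)` pointwise (Lemma 6.2 applied to both signs of `m`, plus truncation).** For `j ≥ 2`
there is `C` such that for `N ≥ 1`, `1 ≤ M`, `2M ≤ 2^K`, `τ ≠ 0`: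
`|B_N(τ)| ≤ 48√2·K|τ|^{-1/2} ∫|H_w(ξ)||D_M(τ+2πξ)|dξ + C (M log(2M) |τ|^{-j} + (1+|τ|)^j N^{-j} M^{2-j})`.
[cite: GuthMaynard2026, Lemma 6.2] -/
theorem norm_coefB_le_main_add (hw : ContDiff ℝ ∞ w) (hsupp : Function.support w ⊆ Set.Icc 1 2)
    {j : ℕ} (hj : 2 ≤ j) : ∃ C, 0 ≤ C ∧ ∀ (N : ℝ), 1 ≤ N → ∀ (M K : ℕ), 1 ≤ M →
      2 * (M : ℝ) ≤ 2 ^ K → ∀ τ : ℝ, τ ≠ 0 →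
      ‖coefB w N τ‖ ≤ 48 * Real.sqrt 2 * K / Real.sqrt |τ| *
          (∫ ξ, ‖mel w ξ‖ * ‖dirD M (τ + 2 * π * ξ)‖) +
        C * ((M : ℝ) * Real.log (2 * M) / |τ| ^ j + (1 + |τ|) ^ j / (N ^ j * (M : ℝ) ^ (j - 2))) := by
  obtain ⟨C₁, hC₁0, hC₁⟩ := norm_coefB_sub_sum_le hw hsupp hj
  obtain ⟨C₂, hC₂0, hC₂⟩ := integral_indicator_norm_mel_le hw hsupp j
  refine ⟨max C₁ (2 * C₂ * (4 * π) ^ j), le_max_of_le_left hC₁0, fun N hN M K hM hK τ hτ ↦ ?_⟩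
  have hN0 : 0 < N := by linarith
  have hM0 : (0 : ℝ) < M := by exact_mod_cast hM
  have hM1 : (1 : ℝ) ≤ M := by exact_mod_cast hM
  have hτ0 : 0 < |τ| := abs_pos.mpr hτ
  have hlog0 : 0 ≤ Real.log (2 * M) := Real.log_nonneg (by linarith)
  set I₁ : ℝ := ∫ ξ, ‖mel w ξ‖ * ‖dirD M (τ + 2 * π * ξ)‖ with hI₁
  have hI₁0 : 0 ≤ I₁ := integral_nonneg fun _ ↦ by positivity
  set Tl : ℝ := ∫ ξ, Set.indicator {ξ : ℝ | |τ| / (4 * π) ≤ |ξ|} (fun ξ ↦ ‖mel w ξ‖) ξ with hTl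
  have hTl : Tl ≤ C₂ / (|τ| / (4 * π)) ^ j := hC₂ _ (by positivity)
  have hTl' : Tl ≤ C₂ * (4 * π) ^ j / |τ| ^ j := by
    refine hTl.trans (le_of_eq ?_)
    rw [div_pow]
    field_simp
  -- the three pieces
  have htr := hC₁ τ N hN M hM
  have hp := norm_sum_fourier_hFun_le hw hsupp 1 hN0 hM hK hτ
  have hm := norm_sum_fourier_hFun_le hw hsupp (-1) hN0 hM hK hτ
  simp only [one_mul] at hp
  simp only [neg_one_mul] at hm
  have hsplit : coefB w N τ = (coefB w N τ - ∑ m ∈ Finset.Icc 1 M,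
      (𝓕 (hFun w τ) (N * m) + 𝓕 (hFun w τ) (-(N * m)))) +
      ∑ m ∈ Finset.Icc 1 M, 𝓕 (hFun w τ) (N * m) + ∑ m ∈ Finset.Icc 1 M, 𝓕 (hFun w τ) (-(N * m)) := by
    rw [Finset.sum_add_distrib]; ring
  rw [hsplit]
  refine (norm_add₃_le).trans ?_
  have hsum : ‖∑ m ∈ Finset.Icc 1 M, 𝓕 (hFun w τ) (N * m)‖ +
      ‖∑ m ∈ Finset.Icc 1 M, 𝓕 (hFun w τ) (-(N * m))‖ ≤
      48 * Real.sqrt 2 * K / Real.sqrt |τ| * I₁ + 2 * (M * Real.log (2 * M) * Tl) := by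
    have := add_le_add hp hm
    refine this.trans (le_of_eq ?_)
    ring
  have hneg : 2 * ((M : ℝ) * Real.log (2 * M) * Tl) ≤
      2 * C₂ * (4 * π) ^ j * ((M : ℝ) * Real.log (2 * M) / |τ| ^ j) := by
    have h1 : (M : ℝ) * Real.log (2 * M) * Tl ≤ (M : ℝ) * Real.log (2 * M) * (C₂ * (4 * π) ^ j / |τ| ^ j) :=
      mul_le_mul_of_nonneg_left hTl' (by positivity)
    refine (mul_le_mul_of_nonneg_left h1 zero_le_two).trans (le_of_eq ?_)
    ring
  have hC' : C₁ * (1 + |τ|) ^ j / (N ^ j * (M : ℝ) ^ (j - 2)) +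
      2 * C₂ * (4 * π) ^ j * ((M : ℝ) * Real.log (2 * M) / |τ| ^ j) ≤
      max C₁ (2 * C₂ * (4 * π) ^ j) *
        ((M : ℝ) * Real.log (2 * M) / |τ| ^ j + (1 + |τ|) ^ j / (N ^ j * (M : ℝ) ^ (j - 2))) := by
    rw [mul_add]
    rw [add_comm]
    refine add_le_add ?_ ?_
    · exact mul_le_mul_of_nonneg_right (le_max_right _ _) (by positivity)
    · rw [mul_div_assoc]
      exact mul_le_mul_of_nonneg_right (le_max_left _ _) (by positivity)
  linarith [hsum, hneg, hC', htr]

/-- **`|B_N(τ)|²` pointwise**, after Cauchy–Schwarz in `ξ` against the weight `|H_w|`: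
`|B_N(τ)|² ≤ 9216 K² ‖H_w‖₁ |τ|^{-1} ∫|H_w(ξ)||D_M(τ+2πξ)|² dξ + 2C²(M log(2M)|τ|^{-j} + (1+|τ|)^j N^{-j}M^{2-j})²`.
[cite: GuthMaynard2026, Section 6 ("Squaring and summing over `t₁, t₂ ∈ W`")] -/
theorem norm_coefB_sq_le (hw : ContDiff ℝ ∞ w) (hsupp : Function.support w ⊆ Set.Icc 1 2)
    {j : ℕ} (hj : 2 ≤ j) : ∃ C, 0 ≤ C ∧ ∀ (N : ℝ), 1 ≤ N → ∀ (M K : ℕ), 1 ≤ M →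
      2 * (M : ℝ) ≤ 2 ^ K → ∀ τ : ℝ, τ ≠ 0 →
      ‖coefB w N τ‖ ^ 2 ≤ 9216 * K ^ 2 * (∫ ξ, ‖mel w ξ‖) / |τ| *
          (∫ ξ, ‖mel w ξ‖ * ‖dirD M (τ + 2 * π * ξ)‖ ^ 2) +
        C * ((M : ℝ) * Real.log (2 * M) / |τ| ^ j + (1 + |τ|) ^ j / (N ^ j * (M : ℝ) ^ (j - 2))) ^ 2 := by
  obtain ⟨C, hC0, hC⟩ := norm_coefB_le_main_add hw hsupp hj
  have hmi := mel_integrable hw hsupp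
  refine ⟨2 * C ^ 2, by positivity, fun N hN M K hM hK τ hτ ↦ ?_⟩
  have hτ0 : 0 < |τ| := abs_pos.mpr hτ
  have h := hC N hN M K hM hK τ hτ
  set I₁ : ℝ := ∫ ξ, ‖mel w ξ‖ * ‖dirD M (τ + 2 * π * ξ)‖ with hI₁
  set I₂ : ℝ := ∫ ξ, ‖mel w ξ‖ * ‖dirD M (τ + 2 * π * ξ)‖ ^ 2 with hI₂
  set L : ℝ := ∫ ξ, ‖mel w ξ‖ with hL
  set E : ℝ := (M : ℝ) * Real.log (2 * M) / |τ| ^ j + (1 + |τ|) ^ j / (N ^ j * (M : ℝ) ^ (j - 2))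
    with hE
  set A : ℝ := 48 * Real.sqrt 2 * K / Real.sqrt |τ| with hA
  have hA0 : 0 ≤ A := by positivity
  have hI₁0 : 0 ≤ I₁ := integral_nonneg fun _ ↦ by positivity
  -- Cauchy–Schwarz
  have hDc : Continuous fun ξ : ℝ ↦ ‖dirD M (τ + 2 * π * ξ)‖ :=
    ((continuous_dirD M).comp (continuous_const.add (continuous_const.mul continuous_id))).norm
  have hCS : I₁ ^ 2 ≤ L * I₂ := by
    refine sq_integral_mul_le (fun _ ↦ norm_nonneg _) (fun _ ↦ norm_nonneg _) hmi.norm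
      hDc.aestronglyMeasurable ?_
    refine hmi.norm.mul_bdd (c := (M : ℝ) ^ 2) (hDc.pow 2).aestronglyMeasurable
      (ae_of_all _ fun ξ ↦ ?_)
    rw [Real.norm_eq_abs, abs_of_nonneg (by positivity)]
    exact pow_le_pow_left₀ (norm_nonneg _) (norm_dirD_le M _) 2
  have h0 : 0 ≤ ‖coefB w N τ‖ := norm_nonneg _
  have h1 : ‖coefB w N τ‖ ^ 2 ≤ (A * I₁ + C * E) ^ 2 := pow_le_pow_left₀ h0 h 2
  have h2 : (A * I₁ + C * E) ^ 2 ≤ 2 * (A * I₁) ^ 2 + 2 * (C * E) ^ 2 := by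
    nlinarith [sq_nonneg (A * I₁ - C * E)]
  have h3 : (A * I₁) ^ 2 ≤ 9216 * K ^ 2 * L / |τ| * I₂ / 2 := by
    rw [mul_pow]
    have hA2 : A ^ 2 = 4608 * K ^ 2 / |τ| := by
      rw [hA, div_pow, mul_pow, mul_pow, Real.sq_sqrt zero_le_two, Real.sq_sqrt hτ0.le]
      ring
    rw [hA2]
    calc 4608 * (K : ℝ) ^ 2 / |τ| * I₁ ^ 2 ≤ 4608 * K ^ 2 / |τ| * (L * I₂) :=
          mul_le_mul_of_nonneg_left hCS (by positivity)
      _ = _ := by ring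
  calc ‖coefB w N τ‖ ^ 2 ≤ 2 * (A * I₁) ^ 2 + 2 * (C * E) ^ 2 := h1.trans h2
    _ ≤ 9216 * K ^ 2 * L / |τ| * I₂ + 2 * C ^ 2 * E ^ 2 := by
        rw [mul_pow C E]; linarith [h3]

/-- Integrability of `ξ ↦ |H_w(ξ)| |D_M(τ + 2πξ)|²`. [folklore] -/
theorem integrable_norm_mel_mul_dirD_sq (hw : ContDiff ℝ ∞ w)
    (hsupp : Function.support w ⊆ Set.Icc 1 2) (M : ℕ) (τ : ℝ) :
    Integrable fun ξ ↦ ‖mel w ξ‖ * ‖dirD M (τ + 2 * π * ξ)‖ ^ 2 := by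
  have hDc : Continuous fun ξ : ℝ ↦ ‖dirD M (τ + 2 * π * ξ)‖ :=
    ((continuous_dirD M).comp (continuous_const.add (continuous_const.mul continuous_id))).norm
  refine (mel_integrable hw hsupp).norm.mul_bdd (c := (M : ℝ) ^ 2) (hDc.pow 2).aestronglyMeasurable
    (ae_of_all _ fun ξ ↦ ?_)
  rw [Real.norm_eq_abs, abs_of_nonneg (by positivity)]
  exact pow_le_pow_left₀ (norm_nonneg _) (norm_dirD_le M _) 2

/-- **The mean square of `B_N` over a dyadic class of differences (§6 of the paper up to (6.2)).**
For `j ≥ 2` there is `C = C(w, j)` such that for `N ≥ 1`, `1 ≤ M`, `2M ≤ 2^K`, `T₀ ≥ 1`, every finite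
`W ⊂ ℝ` and every `Φ` with `∑_{t,t' ∈ W} |D_M(t − t' + 2πξ)|² ≤ Φ` for all `ξ` (a bound for the
double zeta sums of the length-`M` polynomials `∑_{m ≤ M} m^{-2πiξ} m^{i(t'−t)}`, cf. `dirD_sub_add`):
`∑_{t,t' ∈ W, T₀ ≤ |t−t'| ≤ 2T₀} |B_N(t−t')|² ≤ C K² Φ / T₀ + C|W|²((M log 2M)² T₀^{-2j} + (1+2T₀)^{2j} N^{-2j} M^{4-2j})`
("Squaring and summing over `t₁, t₂ ∈ W` with `|t₁−t₂| ∼ NM` gives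
`S₂ ⪅ sup (N²/M) ∑_{t₁≠t₂} |∑_{m ⪅ M} m^{i(t₁−t₂−u)}|² + O(T^{-10})`").
[cite: GuthMaynard2026, Section 6, proof of Proposition 6.1 up to (6.2)] -/
theorem sum_sq_norm_coefB_le (hw : ContDiff ℝ ∞ w) (hsupp : Function.support w ⊆ Set.Icc 1 2)
    {j : ℕ} (hj : 2 ≤ j) : ∃ C, 0 ≤ C ∧
    ∀ (N : ℝ), 1 ≤ N → ∀ (M K : ℕ), 1 ≤ M → 2 * (M : ℝ) ≤ 2 ^ K → ∀ (T₀ : ℝ), 1 ≤ T₀ →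
    ∀ (W : Finset ℝ) (Φ : ℝ),
      (∀ ξ : ℝ, ∑ t ∈ W, ∑ t' ∈ W, ‖dirD M (t - t' + 2 * π * ξ)‖ ^ 2 ≤ Φ) →
      ∑ t ∈ W, ∑ t' ∈ W,
          (if T₀ ≤ |t - t'| ∧ |t - t'| ≤ 2 * T₀ then ‖coefB w N (t - t')‖ ^ 2 else 0) ≤
        C * K ^ 2 * Φ / T₀ + C * (W.card : ℝ) ^ 2 *
          (((M : ℝ) * Real.log (2 * M)) ^ 2 / T₀ ^ (2 * j) +
            (1 + 2 * T₀) ^ (2 * j) / (N ^ (2 * j) * (M : ℝ) ^ (2 * j - 4))) := by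
  obtain ⟨C, hC0, hC⟩ := norm_coefB_sq_le hw hsupp hj
  have hmi := mel_integrable hw hsupp
  set L : ℝ := ∫ ξ, ‖mel w ξ‖ with hL
  have hL0 : 0 ≤ L := integral_nonneg fun _ ↦ norm_nonneg _
  refine ⟨max (9216 * L ^ 2) (2 * C), le_max_of_le_right (by positivity),
    fun N hN M K hM hK T₀ hT₀ W Φ hΦ ↦ ?_⟩
  have hN0 : 0 < N := by linarith
  have hM0 : (0 : ℝ) < M := by exact_mod_cast hM
  have hM1 : (1 : ℝ) ≤ M := by exact_mod_cast hM
  have hT0 : 0 < T₀ := by linarith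
  have hlog0 : 0 ≤ Real.log (2 * M) := Real.log_nonneg (by linarith)
  have hΦ0 : 0 ≤ Φ := le_trans (Finset.sum_nonneg fun _ _ ↦ Finset.sum_nonneg fun _ _ ↦ by positivity) (hΦ 0)
  set I₂ : ℝ → ℝ := fun τ ↦ ∫ ξ, ‖mel w ξ‖ * ‖dirD M (τ + 2 * π * ξ)‖ ^ 2 with hI₂
  have hI₂0 : ∀ τ, 0 ≤ I₂ τ := fun τ ↦ integral_nonneg fun _ ↦ by positivity
  -- the uniform bound for the negligible part on the class
  set Emax : ℝ := ((M : ℝ) * Real.log (2 * M)) ^ 2 / T₀ ^ (2 * j) +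
      (1 + 2 * T₀) ^ (2 * j) / (N ^ (2 * j) * (M : ℝ) ^ (2 * j - 4)) with hEmax
  have hEmax0 : 0 ≤ Emax := by positivity
  have hpt : ∀ τ : ℝ, T₀ ≤ |τ| → |τ| ≤ 2 * T₀ →
      ‖coefB w N τ‖ ^ 2 ≤ 9216 * K ^ 2 * L / T₀ * I₂ τ + 2 * C * Emax := by
    intro τ h1 h2
    have hτ0 : 0 < |τ| := lt_of_lt_of_le hT0 h1
    have hτ : τ ≠ 0 := abs_pos.mp hτ0
    refine (hC N hN M K hM hK τ hτ).trans ?_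
    have ha : 9216 * (K : ℝ) ^ 2 * L / |τ| * I₂ τ ≤ 9216 * K ^ 2 * L / T₀ * I₂ τ := by
      refine mul_le_mul_of_nonneg_right ?_ (hI₂0 τ)
      exact div_le_div_of_nonneg_left (by positivity) hT0 h1
    have hb : ((M : ℝ) * Real.log (2 * M) / |τ| ^ j + (1 + |τ|) ^ j / (N ^ j * (M : ℝ) ^ (j - 2))) ^ 2 ≤
        2 * Emax := by
      have e1 : (M : ℝ) * Real.log (2 * M) / |τ| ^ j ≤ (M : ℝ) * Real.log (2 * M) / T₀ ^ j :=
        div_le_div_of_nonneg_left (by positivity) (by positivity) (pow_le_pow_left₀ hT0.le h1 j)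
      have e2 : (1 + |τ|) ^ j / (N ^ j * (M : ℝ) ^ (j - 2)) ≤ (1 + 2 * T₀) ^ j / (N ^ j * (M : ℝ) ^ (j - 2)) := by
        refine div_le_div_of_nonneg_right ?_ (by positivity)
        exact pow_le_pow_left₀ (by positivity) (by linarith) j
      have e0 : 0 ≤ (M : ℝ) * Real.log (2 * M) / |τ| ^ j := by positivity
      have e0' : 0 ≤ (1 + |τ|) ^ j / (N ^ j * (M : ℝ) ^ (j - 2)) := by positivity
      have hsq : ((M : ℝ) * Real.log (2 * M) / |τ| ^ j + (1 + |τ|) ^ j / (N ^ j * (M : ℝ) ^ (j - 2))) ^ 2 ≤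
          2 * ((M : ℝ) * Real.log (2 * M) / T₀ ^ j) ^ 2 +
            2 * ((1 + 2 * T₀) ^ j / (N ^ j * (M : ℝ) ^ (j - 2))) ^ 2 := by
        nlinarith [e1, e2, e0, e0', sq_nonneg ((M : ℝ) * Real.log (2 * M) / |τ| ^ j -
          (1 + |τ|) ^ j / (N ^ j * (M : ℝ) ^ (j - 2)))]
      refine hsq.trans (le_of_eq ?_)
      have e3 : (N ^ j * (M : ℝ) ^ (j - 2)) ^ 2 = N ^ (2 * j) * (M : ℝ) ^ (2 * j - 4) := by
        rw [mul_pow, ← pow_mul, ← pow_mul]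
        congr 2 <;> omega
      have e4 : ∀ x : ℝ, (x ^ j) ^ 2 = x ^ (2 * j) := fun x ↦ by rw [← pow_mul, mul_comm]
      rw [hEmax, div_pow, div_pow, e4, e4, e3]
      ring
    nlinarith [ha, hb, hC0]
  -- termwise, then drop the condition
  have hterm : ∀ t ∈ W, ∀ t' ∈ W,
      (if T₀ ≤ |t - t'| ∧ |t - t'| ≤ 2 * T₀ then ‖coefB w N (t - t')‖ ^ 2 else 0) ≤
        9216 * K ^ 2 * L / T₀ * I₂ (t - t') + 2 * C * Emax := by
    intro t _ t' _
    split_ifs with h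
    · exact hpt (t - t') h.1 h.2
    · have := hI₂0 (t - t'); positivity
  have hsumI : ∑ t ∈ W, ∑ t' ∈ W, I₂ (t - t') ≤ L * Φ := by
    have hint : ∀ t t' : ℝ, Integrable fun ξ ↦ ‖mel w ξ‖ * ‖dirD M (t - t' + 2 * π * ξ)‖ ^ 2 :=
      fun t t' ↦ integrable_norm_mel_mul_dirD_sq hw hsupp M (t - t')
    have e : ∑ t ∈ W, ∑ t' ∈ W, I₂ (t - t') =
        ∫ ξ, ‖mel w ξ‖ * ∑ t ∈ W, ∑ t' ∈ W, ‖dirD M (t - t' + 2 * π * ξ)‖ ^ 2 := by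
      simp only [hI₂, Finset.mul_sum]
      rw [integral_finsetSum _ (fun t _ ↦ integrable_finsetSum _ (fun t' _ ↦ hint t t'))]
      refine Finset.sum_congr rfl fun t _ ↦ ?_
      rw [integral_finsetSum _ (fun t' _ ↦ hint t t')]
    rw [e]
    calc ∫ ξ, ‖mel w ξ‖ * ∑ t ∈ W, ∑ t' ∈ W, ‖dirD M (t - t' + 2 * π * ξ)‖ ^ 2
        ≤ ∫ ξ, ‖mel w ξ‖ * Φ := by
          refine integral_mono ?_ (hmi.norm.mul_const Φ) fun ξ ↦ ?_
          · have := integrable_finsetSum W (fun t (_ : t ∈ W) ↦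
              integrable_finsetSum W (fun t' (_ : t' ∈ W) ↦ hint t t'))
            refine this.congr (ae_of_all _ fun ξ ↦ ?_)
            simp only [Finset.mul_sum]
          · exact mul_le_mul_of_nonneg_left (hΦ ξ) (norm_nonneg _)
      _ = L * Φ := by rw [integral_mul_const]
  calc ∑ t ∈ W, ∑ t' ∈ W,
        (if T₀ ≤ |t - t'| ∧ |t - t'| ≤ 2 * T₀ then ‖coefB w N (t - t')‖ ^ 2 else 0)
      ≤ ∑ t ∈ W, ∑ t' ∈ W, (9216 * K ^ 2 * L / T₀ * I₂ (t - t') + 2 * C * Emax) :=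
        Finset.sum_le_sum fun t ht ↦ Finset.sum_le_sum fun t' ht' ↦ hterm t ht t' ht'
    _ = 9216 * K ^ 2 * L / T₀ * ∑ t ∈ W, ∑ t' ∈ W, I₂ (t - t') +
        (W.card : ℝ) ^ 2 * (2 * C * Emax) := by
        simp only [Finset.sum_add_distrib, Finset.sum_const, nsmul_eq_mul, ← Finset.mul_sum]
        ring
    _ ≤ 9216 * K ^ 2 * L / T₀ * (L * Φ) + (W.card : ℝ) ^ 2 * (2 * C * Emax) := by
        gcongr
    _ = 9216 * L ^ 2 * K ^ 2 * Φ / T₀ + 2 * C * (W.card : ℝ) ^ 2 * Emax := by ring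
    _ ≤ max (9216 * L ^ 2) (2 * C) * K ^ 2 * Φ / T₀ + max (9216 * L ^ 2) (2 * C) * (W.card : ℝ) ^ 2 * Emax := by
        gcongr
        · exact le_max_left _ _
        · exact le_max_right _ _

end weight

end GuthMaynardS2

end Literature.NumberTheory.LFunctions

end
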